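import Literature.Combinatorics.LorentzianPolynomials.RayleighOptimal
import Literature.Combinatorics.LorentzianPolynomials.ProductLorentzian
import HarnessLib

/-!
# The Rayleigh constant `2(1 - 1/d)` is optimal in every degree: Brändén–Huh's Prop. 2.24 (second statement) for all `d`

Layer `Literature/Combinatorics/LorentzianPolynomials`, namespace `Literature.Combinatorics.LorentzianPolynomials`;
lane `lit-hodgefound` (Track 2 foundations library), seat p16, generation 28 (row g28-#13). Sequel of `RayleighOptimal.lean`
(row g27: the degree-`2` case with `bhQuadratic`). Brändén–Huh's example
`f = 2(1 - 1/d) w_1^d + w_1^{d-1} w_2 + w_1^{d-1} w_3 + w_1^{d-2} w_2 w_3 ∈ L^d_n`, `n ≥ 3`, is not `c`-Rayleigh for any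
`c < 2(1 - 1/d)`, so the constant of Prop. 2.19 (`isCRayleigh_of_mem_lorentzian`, `HodgeRiemann.lean`) is optimal. The
"straightforward" membership `f ∈ L^d_n` is proved on Def. 2.6 by induction on the degree for the two-parameter family
`F_m(s,t) = w_a^m (s w_a² + w_a w_b + w_a w_c + t w_b w_c)` (`f = F_{d-2}(2(1 - 1/d), 1)`), which is Lorentzian whenever
`s, t ≥ 0` and `s t ≤ 2(1 - 1/(m+2))`: in degree `2` by the signature of its Hessian, and for `m + 3` because
`∂_a F_{m+1}(s,t) = (m+2) F_m(s', t')` with `s' t' ≤ 2(1 - 1/(m+2))`, while `∂_b F_{m+1} = w_a^{m+1}(w_a + t w_c)` and the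
support polynomial `F_{m+1}(s/(1+s), t/(1+t))` (same support, `s't' ≤ 1`) are products of Lorentzian polynomials
(Cor. 2.32, `ProductLorentzian.lean`), which supplies the M-convexity of the support.

## Source (verbatim) — P. Brändén, J. Huh, *Lorentzian polynomials* [BrandenHuh2019] (held `paper:arxiv-1902.03719`)

§2.4 Prop. 2.24: "When `n ≤ 2`, all polynomials in `L^d_n` are `1`-Rayleigh. When `n ≥ 3`, we have (all polynomials in
`L^d_n` are `c`-Rayleigh) ⟹ `c ≥ 2(1 - 1/d)`. In other words, for any `n ≥ 3` and any `c < 2(1 - 1/d)`, there is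
`f ∈ L^d_n` that is not `c`-Rayleigh. […] To see the second statement, consider the polynomial
`f = 2(1 - 1/d) w_1^d + w_1^{d-1} w_2 + w_1^{d-1} w_3 + w_1^{d-2} w_2 w_3`. It is straightforward to check that `f` is in
`L^d_n`. If `f` is `c`-Rayleigh, then, for any `w ∈ ℝ^n_{≥0}`,
`w_1^{2d-4}(2(1 - 1/d) w_1^2 + w_1 w_2 + w_1 w_3 + w_2 w_3) ≤ c w_1^{2d-4}(w_1 + w_2)(w_1 + w_3)`. The desired lower bound for
`c` is obtained by setting `w_1 = 1, w_2 = 0, w_3 = 0`."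

## What is here (`a, b, c ∈ σ` distinct)

* §1 `bhQuadraticST a b c s t = s w_a² + w_a w_b + w_a w_c + t w_b w_c` and **`bhQuadraticST_mem_lorentzian`** (`s, t ≥ 0`,
  `s t ≤ 1`); `bhPoly a b c m s t = w_a^m · bhQuadraticST a b c s t` (`= F_m(s,t)`), its monomial expansion, coefficients,
  homogeneity, `pderiv_a/b/c_bhPoly`;
* §2 `isMConvex_support_bhPoly` (via the Lorentzian product `F_m(s/(1+s), t/(1+t))`) and **`bhPoly_mem_lorentzian`**
  (`s, t ≥ 0`, `s t ≤ 2(1 - 1/(m+2))` ⟹ `F_m(s,t) ∈ L^{m+2}`), in particular `bhPoly_mem_lorentzian_bh`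
  (`f ∈ L^d_n`);
* §3 `not_isCRayleigh_bhPoly` and **`exists_mem_lorentzian_not_isCRayleigh`** (Prop. 2.24, second statement, every `d ≥ 2`),
  `le_of_forall_lorentzian_isCRayleigh` and the optimality `forall_lorentzian_isCRayleigh_iff` (with Prop. 2.19).

Two definitions with bodies (`bhQuadraticST`, `bhPoly`), theorems otherwise; no `sorry`, no named fact (net debt 0). The
first statement of Prop. 2.24 (`n ≤ 2`: all of `L^d_n` is `1`-Rayleigh) is not treated. -- TODO(general form): `n ≤ 2`.

## References

* [BrandenHuh2019] P. Brändén, J. Huh, *Lorentzian polynomials*, Ann. of Math. (2) 192 (2020) 821–891, arXiv:1902.03719 —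
  §2.4 Prop. 2.24 and its proof; Prop. 2.19; §2.2 Def. 2.6; §2.5 Cor. 2.32.
-/

noncomputable section

open MvPolynomial Finsupp Finset Matrix
open Literature.LinearAlgebra.QuadraticForm

namespace Literature.Combinatorics.LorentzianPolynomials

variable {σ : Type*} [Fintype σ]

/-! ## §1 The family `F_m(s,t) = w_a^m (s w_a² + w_a w_b + w_a w_c + t w_b w_c)` -/

section Family

/-- The quadratic `s w_a² + w_a w_b + w_a w_c + t w_b w_c` (`bhQuadratic = ` the case `s = t = 1`).
[cite: BrandenHuh2019, §2.4 proof of Prop. 2.24 ("`2(1 - 1/d) w_1^2 + w_1 w_2 + w_1 w_3 + w_2 w_3`")] -/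
def bhQuadraticST (a b c : σ) (s t : ℝ) : MvPolynomial σ ℝ :=
  C s * (X a * X a) + X a * X b + X a * X c + C t * (X b * X c)

/-- **`F_m(s,t) = w_a^m (s w_a² + w_a w_b + w_a w_c + t w_b w_c)`**; Brändén–Huh's `f` is `F_{d-2}(2(1 - 1/d), 1)`.
[cite: BrandenHuh2019, §2.4 proof of Prop. 2.24 ("`w_1^{2d-4}(2(1 - 1/d) w_1^2 + w_1 w_2 + w_1 w_3 + w_2 w_3)`")] -/
def bhPoly (a b c : σ) (m : ℕ) (s t : ℝ) : MvPolynomial σ ℝ := X a ^ m * bhQuadraticST a b c s t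

omit [Fintype σ] in
/-- `F_m(s,t)` as a sum of four monomials. [cite: BrandenHuh2019, §2.4 proof of Prop. 2.24] -/
theorem bhPoly_eq (a b c : σ) (m : ℕ) (s t : ℝ) :
    bhPoly a b c m s t = monomial (Finsupp.single a (m + 2)) s + monomial (Finsupp.single a (m + 1) + Finsupp.single b 1) 1 +
      monomial (Finsupp.single a (m + 1) + Finsupp.single c 1) 1 +
      monomial (Finsupp.single a m + Finsupp.single b 1 + Finsupp.single c 1) t := by
  rw [bhPoly, bhQuadraticST, X_pow_eq_monomial, X, X, X, C_apply, C_apply]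
  simp only [mul_add, monomial_mul, one_mul, mul_one]
  have h2 : Finsupp.single a m + (0 + (Finsupp.single a 1 + Finsupp.single a 1)) = Finsupp.single a (m + 2) := by
    rw [zero_add, ← Finsupp.single_add, ← Finsupp.single_add]
  have h1 : ∀ k : σ, Finsupp.single a m + (Finsupp.single a 1 + Finsupp.single k 1) =
      Finsupp.single a (m + 1) + Finsupp.single k 1 := fun k ↦ by rw [← add_assoc, ← Finsupp.single_add]
  have h0 : Finsupp.single a m + (0 + (Finsupp.single b 1 + Finsupp.single c 1)) =
      Finsupp.single a m + Finsupp.single b 1 + Finsupp.single c 1 := by rw [zero_add, add_assoc]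
  rw [h2, h1 b, h1 c, h0]

omit [Fintype σ] in
/-- The four exponents of `F_m(s,t)` are pairwise distinct (for `a, b, c` distinct).
[cite: BrandenHuh2019, §2.4 proof of Prop. 2.24] -/
private theorem exps_ne {a b c : σ} (hab : a ≠ b) (hac : a ≠ c) (hbc : b ≠ c) (m : ℕ) :
    (Finsupp.single a (m + 2) : σ →₀ ℕ) ≠ Finsupp.single a (m + 1) + Finsupp.single b 1 ∧
    (Finsupp.single a (m + 2) : σ →₀ ℕ) ≠ Finsupp.single a (m + 1) + Finsupp.single c 1 ∧
    (Finsupp.single a (m + 2) : σ →₀ ℕ) ≠ Finsupp.single a m + Finsupp.single b 1 + Finsupp.single c 1 ∧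
    (Finsupp.single a (m + 1) + Finsupp.single b 1 : σ →₀ ℕ) ≠ Finsupp.single a (m + 1) + Finsupp.single c 1 ∧
    (Finsupp.single a (m + 1) + Finsupp.single b 1 : σ →₀ ℕ) ≠ Finsupp.single a m + Finsupp.single b 1 + Finsupp.single c 1 ∧
    (Finsupp.single a (m + 1) + Finsupp.single c 1 : σ →₀ ℕ) ≠
      Finsupp.single a m + Finsupp.single b 1 + Finsupp.single c 1 := by
  refine ⟨fun h ↦ ?_, fun h ↦ ?_, fun h ↦ ?_, fun h ↦ ?_, fun h ↦ ?_, fun h ↦ ?_⟩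
  · have := congrArg (· b) h; simp [hab] at this
  · have := congrArg (· c) h; simp [hac] at this
  · have := congrArg (· b) h; simp [hab, Ne.symm hbc] at this
  · have := congrArg (· b) h; simp [hab, Ne.symm hbc] at this
  · have := congrArg (· c) h; simp [hac, hbc] at this
  · have := congrArg (· b) h; simp [hab, Ne.symm hbc] at this

omit [Fintype σ] in
/-- **The coefficients of `F_m(s,t)`**: `s`, `1`, `1`, `t` at the four exponents (as a sum of indicators).
[cite: BrandenHuh2019, §2.4 proof of Prop. 2.24] -/
theorem coeff_bhPoly [DecidableEq σ] (a b c : σ) (m : ℕ) (s t : ℝ) (β : σ →₀ ℕ) :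
    coeff β (bhPoly a b c m s t) =
      (if Finsupp.single a (m + 2) = β then s else 0) +
      (if Finsupp.single a (m + 1) + Finsupp.single b 1 = β then 1 else 0) +
      (if Finsupp.single a (m + 1) + Finsupp.single c 1 = β then 1 else 0) +
      (if Finsupp.single a m + Finsupp.single b 1 + Finsupp.single c 1 = β then t else 0) := by
  rw [bhPoly_eq, coeff_add, coeff_add, coeff_add, coeff_monomial, coeff_monomial, coeff_monomial, coeff_monomial]

omit [Fintype σ] in
/-- The support of `F_m(s,t)` depends only on which of `s`, `t` vanish. [cite: BrandenHuh2019, §2.4 proof of Prop. 2.24] -/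
theorem coeff_bhPoly_ne_zero_iff [DecidableEq σ] {a b c : σ} (hab : a ≠ b) (hac : a ≠ c) (hbc : b ≠ c) (m : ℕ)
    {s t s' t' : ℝ} (hs : s = 0 ↔ s' = 0) (ht : t = 0 ↔ t' = 0) (β : σ →₀ ℕ) :
    coeff β (bhPoly a b c m s t) ≠ 0 ↔ coeff β (bhPoly a b c m s' t') ≠ 0 := by
  obtain ⟨h12, h13, h14, h23, h24, h34⟩ := exps_ne hab hac hbc m
  rw [coeff_bhPoly, coeff_bhPoly]
  by_cases e1 : Finsupp.single a (m + 2) = β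
  · subst e1
    simp only [if_true, if_neg h12.symm, if_neg h13.symm, if_neg h14.symm, add_zero]
    exact not_congr hs
  by_cases e2 : Finsupp.single a (m + 1) + Finsupp.single b 1 = β
  · subst e2
    simp only [if_true, if_neg e1, if_neg h23.symm, if_neg h24.symm]
  by_cases e3 : Finsupp.single a (m + 1) + Finsupp.single c 1 = β
  · subst e3
    simp only [if_true, if_neg e1, if_neg e2, if_neg h34.symm]
  by_cases e4 : Finsupp.single a m + Finsupp.single b 1 + Finsupp.single c 1 = β
  · subst e4
    simp only [if_true, if_neg e1, if_neg e2, if_neg e3, zero_add]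
    exact not_congr ht
  · simp only [if_neg e1, if_neg e2, if_neg e3, if_neg e4]

omit [Fintype σ] in
/-- The coefficients of `F_m(s,t)` are nonnegative for `s, t ≥ 0`. [cite: BrandenHuh2019, §2.4 proof of Prop. 2.24] -/
theorem coeff_bhPoly_nonneg [DecidableEq σ] (a b c : σ) (m : ℕ) {s t : ℝ} (hs : 0 ≤ s) (ht : 0 ≤ t) (β : σ →₀ ℕ) :
    0 ≤ coeff β (bhPoly a b c m s t) := by
  rw [coeff_bhPoly]
  refine add_nonneg (add_nonneg (add_nonneg ?_ ?_) ?_) ?_ <;> split_ifs <;>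
    first | exact hs | exact ht | exact zero_le_one | exact le_rfl

omit [Fintype σ] in
/-- `s w_a² + w_a w_b + w_a w_c + t w_b w_c` is homogeneous of degree `2`. [cite: BrandenHuh2019, §2.4 proof of Prop. 2.24] -/
theorem isHomogeneous_bhQuadraticST (a b c : σ) (s t : ℝ) : (bhQuadraticST a b c s t).IsHomogeneous 2 := by
  have hX : ∀ i j : σ, (X i * X j : MvPolynomial σ ℝ).IsHomogeneous 2 := fun i j ↦
    (isHomogeneous_X ℝ i).mul (isHomogeneous_X ℝ j)
  have hC : ∀ (r : ℝ) (i j : σ), (C r * (X i * X j) : MvPolynomial σ ℝ).IsHomogeneous 2 := fun r i j ↦ by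
    simpa using (isHomogeneous_C σ r).mul (hX i j)
  exact (((hC s a a).add (hX a b)).add (hX a c)).add (hC t b c)

omit [Fintype σ] in
/-- `F_m(s,t)` is homogeneous of degree `m + 2`. [cite: BrandenHuh2019, §2.4 proof of Prop. 2.24] -/
theorem isHomogeneous_bhPoly (a b c : σ) (m : ℕ) (s t : ℝ) : (bhPoly a b c m s t).IsHomogeneous (m + 2) := by
  have h := ((isHomogeneous_X ℝ a).pow m).mul (isHomogeneous_bhQuadraticST a b c s t)
  simpa [bhPoly] using h

omit [Fintype σ] in
/-- `f(x) = x_a^m (s x_a² + x_a x_b + x_a x_c + t x_b x_c)`. [cite: BrandenHuh2019, §2.4 proof of Prop. 2.24] -/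
theorem eval_bhPoly (a b c : σ) (m : ℕ) (s t : ℝ) (x : σ → ℝ) :
    eval x (bhPoly a b c m s t) = x a ^ m * (s * (x a * x a) + x a * x b + x a * x c + t * (x b * x c)) := by
  simp only [bhPoly, bhQuadraticST, map_add, map_mul, map_pow, eval_X, eval_C]

omit [Fintype σ] in
/-- `∂_a (s w_a² + w_a w_b + w_a w_c + t w_b w_c) = 2 s w_a + w_b + w_c` (written `s(w_a + w_a) + w_b + w_c`).
[cite: BrandenHuh2019, §2.4 proof of Prop. 2.24] -/
theorem pderiv_a_bhQuadraticST [DecidableEq σ] {a b c : σ} (hab : a ≠ b) (hac : a ≠ c) (s t : ℝ) :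
    pderiv a (bhQuadraticST a b c s t) = C s * (X a + X a) + X b + X c := by
  simp only [bhQuadraticST, map_add, pderiv_mul, pderiv_C, pderiv_X_self, pderiv_X_of_ne (Ne.symm hab),
    pderiv_X_of_ne (Ne.symm hac), zero_mul, mul_zero, add_zero, zero_add, mul_one, one_mul]

omit [Fintype σ] in
/-- **`∂_a F_{m+1}(s,t) = (m+2) · F_m(s', t')`** with `(m+2) s' = (m+3) s`, `(m+2) t' = (m+1) t`.
[cite: BrandenHuh2019, §2.4 proof of Prop. 2.24 ("straightforward to check that `f` is in `L^d_n`"); §2.2 Def. 2.6] -/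
theorem pderiv_a_bhPoly [DecidableEq σ] {a b c : σ} (hab : a ≠ b) (hac : a ≠ c) (m : ℕ) {s t s' t' : ℝ}
    (hs' : ((m + 2 : ℕ) : ℝ) * s' = ((m + 3 : ℕ) : ℝ) * s) (ht' : ((m + 2 : ℕ) : ℝ) * t' = ((m + 1 : ℕ) : ℝ) * t) :
    pderiv a (bhPoly a b c (m + 1) s t) = C ((m + 2 : ℕ) : ℝ) * bhPoly a b c m s' t' := by
  have hsC : (((m + 2 : ℕ) : MvPolynomial σ ℝ) * C s' : MvPolynomial σ ℝ) = ((m + 3 : ℕ) : MvPolynomial σ ℝ) * C s := by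
    have h := congrArg (C : ℝ → MvPolynomial σ ℝ) hs'
    simpa only [map_mul, map_natCast] using h
  have htC : (((m + 2 : ℕ) : MvPolynomial σ ℝ) * C t' : MvPolynomial σ ℝ) = ((m + 1 : ℕ) : MvPolynomial σ ℝ) * C t := by
    have h := congrArg (C : ℝ → MvPolynomial σ ℝ) ht'
    simpa only [map_mul, map_natCast] using h
  have hpow : pderiv a (X a ^ (m + 1) : MvPolynomial σ ℝ) = ((m + 1 : ℕ) : MvPolynomial σ ℝ) * X a ^ m := by
    rw [pderiv_pow, pderiv_X_self, mul_one, Nat.add_sub_cancel]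
  rw [bhPoly, pderiv_mul, hpow, pderiv_a_bhQuadraticST hab hac, bhPoly, bhQuadraticST, bhQuadraticST, map_natCast]
  push_cast at hsC htC ⊢
  linear_combination (-(X a ^ m * (X a * X a))) * hsC + (-(X a ^ m * (X b * X c))) * htC

omit [Fintype σ] in
/-- `∂_b F_m(s,t) = w_a^m (w_a + t w_c)`. [cite: BrandenHuh2019, §2.4 proof of Prop. 2.24 ("`(w_1 + w_2)(w_1 + w_3)`")] -/
theorem pderiv_b_bhPoly [DecidableEq σ] {a b c : σ} (hab : a ≠ b) (hbc : b ≠ c) (m : ℕ) (s t : ℝ) :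
    pderiv b (bhPoly a b c m s t) = X a ^ m * (X a + C t * X c) := by
  simp only [bhPoly, bhQuadraticST, pderiv_mul, pderiv_pow, pderiv_X_self, pderiv_X_of_ne hab,
    pderiv_X_of_ne (Ne.symm hbc), pderiv_C, map_add, mul_one, one_mul, mul_zero, zero_mul, add_zero, zero_add]

omit [Fintype σ] in
/-- `∂_c F_m(s,t) = w_a^m (w_a + t w_b)`. [cite: BrandenHuh2019, §2.4 proof of Prop. 2.24] -/
theorem pderiv_c_bhPoly [DecidableEq σ] {a b c : σ} (hac : a ≠ c) (hbc : b ≠ c) (m : ℕ) (s t : ℝ) :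
    pderiv c (bhPoly a b c m s t) = X a ^ m * (X a + C t * X b) := by
  simp only [bhPoly, bhQuadraticST, pderiv_mul, pderiv_pow, pderiv_X_self, pderiv_X_of_ne hac,
    pderiv_X_of_ne hbc, pderiv_C, map_add, mul_one, mul_zero, zero_mul, add_zero, zero_add]

omit [Fintype σ] in
/-- `∂_k F_m(s,t) = 0` for `k ∉ {a, b, c}`. [cite: BrandenHuh2019, §2.4 proof of Prop. 2.24] -/
theorem pderiv_other_bhPoly [DecidableEq σ] {a b c k : σ} (hka : a ≠ k) (hkb : b ≠ k) (hkc : c ≠ k) (m : ℕ) (s t : ℝ) :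
    pderiv k (bhPoly a b c m s t) = 0 := by
  simp only [bhPoly, bhQuadraticST, pderiv_mul, pderiv_pow, pderiv_X_of_ne hka, pderiv_X_of_ne hkb,
    pderiv_X_of_ne hkc, pderiv_C, map_add, mul_zero, zero_mul, add_zero]

/-- `w_i ∈ L^1`. [cite: BrandenHuh2019, §2.2 Def. 2.6 (`L^1_n`)] -/
theorem X_mem_lorentzian_one [DecidableEq σ] (i : σ) : (X i : MvPolynomial σ ℝ) ∈ lorentzian σ 1 :=
  mem_lorentzian_one.2 ⟨isHomogeneous_X ℝ i, fun β ↦ by rw [X, coeff_monomial]; split_ifs <;> norm_num⟩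

/-- `w_i + t w_j ∈ L^1` for `t ≥ 0`. [cite: BrandenHuh2019, §2.2 Def. 2.6 (`L^1_n`)] -/
theorem X_add_C_mul_X_mem_lorentzian_one [DecidableEq σ] (i j : σ) {t : ℝ} (ht : 0 ≤ t) :
    (X i + C t * X j : MvPolynomial σ ℝ) ∈ lorentzian σ 1 :=
  mem_lorentzian_one.2 ⟨(isHomogeneous_X ℝ i).add (by simpa using (isHomogeneous_C σ t).mul (isHomogeneous_X ℝ j)),
    fun β ↦ by
      rw [coeff_add, X, X, coeff_monomial, coeff_C_mul, coeff_monomial]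
      split_ifs <;> nlinarith⟩

/-- `w_a^m ∈ L^m` (Cor. 2.32). [cite: BrandenHuh2019, §2.5 Cor. 2.32] -/
theorem X_pow_mem_lorentzian [DecidableEq σ] (i : σ) (m : ℕ) : (X i ^ m : MvPolynomial σ ℝ) ∈ lorentzian σ m := by
  simpa using pow_mem_lorentzian (X_mem_lorentzian_one i) m

end Family

/-! ## §2 `F_m(s,t)` is Lorentzian for `s t ≤ 2(1 - 1/(m+2))` -/

section Lorentzian

variable [DecidableEq σ]

/-- **Degree two**: `s w_a² + w_a w_b + w_a w_c + t w_b w_c ∈ L^2` for `s, t ≥ 0`, `s t ≤ 1` (`a ≠ b, c`). On the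
`𝓗`-orthogonal complement `{2 s z_a + z_b + z_c = 0}` of `e_a` the form is `-2 s z_a² + 2 t z_b z_c ≤ 0`.
[cite: BrandenHuh2019, §2.4 proof of Prop. 2.24 ("straightforward to check"); §2.2 Def. 2.6] -/
theorem bhQuadraticST_mem_lorentzian {a b c : σ} (hab : a ≠ b) (hac : a ≠ c) {s t : ℝ} (hs : 0 ≤ s) (ht : 0 ≤ t)
    (hst : s * t ≤ 1) : bhQuadraticST a b c s t ∈ lorentzian σ 2 := by
  have hq := isHomogeneous_bhQuadraticST a b c s t
  have hev : ∀ x : σ → ℝ, eval x (bhQuadraticST a b c s t) = s * (x a * x a) + x a * x b + x a * x c + t * (x b * x c) :=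
    fun x ↦ by simp only [bhQuadraticST, map_add, map_mul, eval_X, eval_C]
  refine mem_lorentzian_two_iff_sigPos.2 ⟨hq, fun β ↦ ?_, ?_⟩
  · have h := coeff_bhPoly_nonneg a b c 0 hs ht β
    rwa [bhPoly, pow_zero, one_mul] at h
  · refine sigPos_le_one_of_orthogonal_nonpos (Matrix.toBilin' (hessian (bhQuadraticST a b c s t))) (w := Pi.single a 1)
      fun z hz ↦ ?_
    rw [toBilin'_hessian_eq_eval hq, hev, hev, hev] at hz
    simp only [Pi.add_apply, Pi.single_eq_same, Pi.single_eq_of_ne' hab, Pi.single_eq_of_ne' hac] at hz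
    rw [← two_mul_eval_eq_toBilin'_hessian hq, hev]
    -- `hz : 2 s z_a + z_b + z_c = 0`
    have hz' : 2 * s * z a + z b + z c = 0 := by linarith
    by_cases hbc : 0 ≤ z b * z c
    · -- `4 s · q(z) = -(z_b + z_c)² + 4 s t z_b z_c ≤ -(z_b - z_c)² ≤ 0`
      have key : 4 * s * (s * (z a * z a) + z a * z b + z a * z c + t * (z b * z c)) =
          -(z b + z c) ^ 2 + 4 * (s * t) * (z b * z c) := by
        linear_combination (2 * s * z a + z b + z c) * hz'
      have h4 : 4 * s * (s * (z a * z a) + z a * z b + z a * z c + t * (z b * z c)) ≤ 0 := by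
        rw [key]
        nlinarith [mul_nonneg (sub_nonneg.2 hst) hbc, sq_nonneg (z b - z c)]
      rcases hs.eq_or_lt with hs0 | hs0
      · -- `s = 0`: then `z_b = -z_c`, `z_b z_c ≥ 0` forces `z_b = z_c = 0`
        subst hs0
        have hbc' : z c = -z b := by linarith
        rw [hbc'] at hbc
        have hb0 : z b = 0 := by nlinarith [sq_nonneg (z b)]
        rw [hbc', hb0]
        simp
      · have : s * (s * (z a * z a) + z a * z b + z a * z c + t * (z b * z c)) ≤ 0 := by nlinarith
        nlinarith [this]
    · push Not at hbc
      have key : s * (z a * z a) + z a * z b + z a * z c + t * (z b * z c) = -(s * (z a * z a)) + t * (z b * z c) := by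
        linear_combination (z a) * hz'
      rw [key]
      nlinarith [mul_nonneg hs (mul_self_nonneg (z a)), mul_nonneg ht (le_of_lt (neg_pos.2 hbc))]

/-- `w_a^m (w_a + t w_k) ∈ L^{m+1}` for `t ≥ 0` (a product of Lorentzian polynomials, Cor. 2.32).
[cite: BrandenHuh2019, §2.5 Cor. 2.32; §2.2 Def. 2.6] -/
theorem X_pow_mul_linear_mem_lorentzian (a k : σ) (m : ℕ) {t : ℝ} (ht : 0 ≤ t) :
    (X a ^ m * (X a + C t * X k) : MvPolynomial σ ℝ) ∈ lorentzian σ (m + 1) := by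
  have h := mul_mem_lorentzian (X_pow_mem_lorentzian a m) (X_add_C_mul_X_mem_lorentzian_one a k ht)
  exact h

/-- **The support of `F_m(s,t)` is M-convex** (`s, t ≥ 0`): it coincides with the support of
`F_m(s/(1+s), t/(1+t)) = w_a^m · q` with `q = bhQuadraticST a b c (s/(1+s)) (t/(1+t)) ∈ L^2` (`s't' ≤ 1`), a product of
Lorentzian polynomials (Cor. 2.32), whose support is M-convex by Def. 2.6. [cite: BrandenHuh2019, §2.4 proof of
Prop. 2.24 ("straightforward to check that `f` is in `L^d_n`"); §2.5 Cor. 2.32; §2.2 Def. 2.6] -/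
theorem isMConvex_support_bhPoly {a b c : σ} (hab : a ≠ b) (hac : a ≠ c) (hbc : b ≠ c) (m : ℕ) {s t : ℝ} (hs : 0 ≤ s)
    (ht : 0 ≤ t) : IsMConvex {β : σ →₀ ℕ | coeff β (bhPoly a b c m s t) ≠ 0} := by
  set s' := s / (1 + s) with hs'
  set t' := t / (1 + t) with ht'
  have hs'0 : 0 ≤ s' := div_nonneg hs (by linarith)
  have ht'0 : 0 ≤ t' := div_nonneg ht (by linarith)
  have hs'1 : s' ≤ 1 := by rw [hs', div_le_one (by linarith)]; linarith
  have ht'1 : t' ≤ 1 := by rw [ht', div_le_one (by linarith)]; linarith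
  have hmem : bhPoly a b c m s' t' ∈ lorentzian σ (m + 2) := by
    have h := mul_mem_lorentzian (X_pow_mem_lorentzian a m)
      (bhQuadraticST_mem_lorentzian hab hac hs'0 ht'0 (by nlinarith))
    exact h
  have hsupp : {β : σ →₀ ℕ | coeff β (bhPoly a b c m s t) ≠ 0} = {β : σ →₀ ℕ | coeff β (bhPoly a b c m s' t') ≠ 0} := by
    ext β
    exact coeff_bhPoly_ne_zero_iff hab hac hbc m
      (by rw [hs', div_eq_zero_iff]; constructor <;> intro h <;> [exact Or.inl h; exact h.resolve_right (by linarith)])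
      (by rw [ht', div_eq_zero_iff]; constructor <;> intro h <;> [exact Or.inl h; exact h.resolve_right (by linarith)]) β
  rw [hsupp]
  exact isMConvex_support_of_mem_lorentzian hmem

/-- **`F_m(s,t) ∈ L^{m+2}` whenever `s, t ≥ 0` and `s t ≤ 2(1 - 1/(m+2))`** — by induction on `m` along Def. 2.6:
`∂_a F_{m+1}(s,t) = (m+2) F_m(s',t')` with `s' t' ≤ 2(1 - 1/(m+2))`, `∂_b F_{m+1} = w_a^{m+1}(w_a + t w_c)`,
`∂_c F_{m+1} = w_a^{m+1}(w_a + t w_b)`, M-convex support. In particular Brändén–Huh's `f = F_{d-2}(2(1 - 1/d), 1) ∈ L^d_n`.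
[cite: BrandenHuh2019, §2.4 proof of Prop. 2.24 ("It is straightforward to check that `f` is in `L^d_n`"); §2.2 Def. 2.6] -/
theorem bhPoly_mem_lorentzian {a b c : σ} (hab : a ≠ b) (hac : a ≠ c) (hbc : b ≠ c) :
    ∀ (m : ℕ) {s t : ℝ}, 0 ≤ s → 0 ≤ t → s * t ≤ 2 * (1 - 1 / ((m : ℝ) + 2)) →
      bhPoly a b c m s t ∈ lorentzian σ (m + 2)
  | 0, s, t, hs, ht, hst => by
    rw [bhPoly, pow_zero, one_mul]
    exact bhQuadraticST_mem_lorentzian hab hac hs ht (by norm_num at hst; linarith)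
  | m + 1, s, t, hs, ht, hst => by
    rw [show m + 1 + 2 = m + 3 by ring, mem_lorentzian_add_three]
    refine ⟨isHomogeneous_bhPoly a b c (m + 1) s t, coeff_bhPoly_nonneg a b c (m + 1) hs ht,
      isMConvex_support_bhPoly hab hac hbc (m + 1) hs ht, fun k ↦ ?_⟩
    by_cases hka : k = a
    · subst hka
      -- `∂_a F_{m+1}(s,t) = (m+2) F_m(s',t')`
      set s' := ((m + 3 : ℕ) : ℝ) * s / ((m + 2 : ℕ) : ℝ) with hs'
      set t' := ((m + 1 : ℕ) : ℝ) * t / ((m + 2 : ℕ) : ℝ) with ht'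
      have hm2 : (0 : ℝ) < ((m + 2 : ℕ) : ℝ) := by positivity
      have hs'e : ((m + 2 : ℕ) : ℝ) * s' = ((m + 3 : ℕ) : ℝ) * s := by rw [hs']; field_simp
      have ht'e : ((m + 2 : ℕ) : ℝ) * t' = ((m + 1 : ℕ) : ℝ) * t := by rw [ht']; field_simp
      rw [pderiv_a_bhPoly hab hac m hs'e ht'e, ← smul_eq_C_mul]
      refine smul_mem_lorentzian (bhPoly_mem_lorentzian hab hac hbc m (by positivity) (by positivity) ?_) (by positivity)
      -- `s' t' = s t (m+3)(m+1)/(m+2)² ≤ 2(1 - 1/(m+3)) (m+3)(m+1)/(m+2)² = 2(m+1)/(m+2) = 2(1 - 1/(m+2))`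
      have h1 : s' * t' = s * t * ((((m + 3 : ℕ) : ℝ) * ((m + 1 : ℕ) : ℝ)) / (((m + 2 : ℕ) : ℝ) ^ 2)) := by
        rw [hs', ht']; field_simp
      have h2 : 2 * (1 - 1 / (((m + 1 : ℕ) : ℝ) + 2)) = 2 * ((m + 2 : ℕ) : ℝ) / ((m + 3 : ℕ) : ℝ) := by
        push_cast; field_simp; ring
      have h3 : 2 * (1 - 1 / ((m : ℝ) + 2)) = 2 * ((m + 1 : ℕ) : ℝ) / ((m + 2 : ℕ) : ℝ) := by
        push_cast; field_simp; ring
      rw [h2] at hst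
      rw [h1, h3]
      have hpos : 0 ≤ (((m + 3 : ℕ) : ℝ) * ((m + 1 : ℕ) : ℝ)) / (((m + 2 : ℕ) : ℝ) ^ 2) := by positivity
      calc s * t * ((((m + 3 : ℕ) : ℝ) * ((m + 1 : ℕ) : ℝ)) / (((m + 2 : ℕ) : ℝ) ^ 2))
          ≤ (2 * ((m + 2 : ℕ) : ℝ) / ((m + 3 : ℕ) : ℝ)) * ((((m + 3 : ℕ) : ℝ) * ((m + 1 : ℕ) : ℝ)) / (((m + 2 : ℕ) : ℝ) ^ 2)) :=
            mul_le_mul_of_nonneg_right hst hpos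
        _ = 2 * ((m + 1 : ℕ) : ℝ) / ((m + 2 : ℕ) : ℝ) := by field_simp
    by_cases hkb : k = b
    · subst hkb
      rw [pderiv_b_bhPoly hab hbc]
      exact X_pow_mul_linear_mem_lorentzian a c (m + 1) ht
    by_cases hkc : k = c
    · subst hkc
      rw [pderiv_c_bhPoly hac hbc]
      exact X_pow_mul_linear_mem_lorentzian a b (m + 1) ht
    · rw [pderiv_other_bhPoly (Ne.symm hka) (Ne.symm hkb) (Ne.symm hkc)]
      exact zero_mem_lorentzian _

/-- **Brändén–Huh's `f = 2(1 - 1/d) w_a^d + w_a^{d-1} w_b + w_a^{d-1} w_c + w_a^{d-2} w_b w_c` is in `L^d_n`** (`d ≥ 2`,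
`a, b, c` distinct). [cite: BrandenHuh2019, §2.4 proof of Prop. 2.24 ("It is straightforward to check that `f` is in
`L^d_n`")] -/
theorem bhPoly_mem_lorentzian_bh {a b c : σ} (hab : a ≠ b) (hac : a ≠ c) (hbc : b ≠ c) (m : ℕ) :
    bhPoly a b c m (2 * (1 - 1 / ((m : ℝ) + 2))) 1 ∈ lorentzian σ (m + 2) :=
  bhPoly_mem_lorentzian hab hac hbc m (by
    have : (1 : ℝ) / ((m : ℝ) + 2) ≤ 1 := by rw [div_le_one (by positivity)]; linarith
    linarith) zero_le_one (by rw [mul_one])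

end Lorentzian

/-! ## §3 `f` is not `c`-Rayleigh for `c < 2(1 - 1/d)`; Proposition 2.24 in every degree -/

section Optimal

variable [DecidableEq σ]

/-- **`F_m(s,t)` is not `c`-Rayleigh for `c < s t`**: Def. 2.18 at `α = 0`, `i = b`, `j = c`, `w = e_a` reads
`F(e_a) ∂_b∂_c F(e_a) = s · t ≤ c = c ∂_b F(e_a) ∂_c F(e_a)` ("The desired lower bound for `c` is obtained by setting
`w_1 = 1, w_2 = 0, w_3 = 0`"). [cite: BrandenHuh2019, §2.4 proof of Prop. 2.24] -/
theorem not_isCRayleigh_bhPoly {a b c : σ} (hab : a ≠ b) (hac : a ≠ c) (hbc : b ≠ c) (m : ℕ) {s t r : ℝ}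
    (hr : r < s * t) : ¬ IsCRayleigh r (bhPoly a b c m s t) := by
  intro h
  have hle := h.eval_mul_eval_pderiv_pderiv_le b c (w := Pi.single a 1) fun k ↦ by
    by_cases hk : k = a
    · subst hk; rw [Pi.single_eq_same]; exact zero_le_one
    · rw [Pi.single_eq_of_ne hk]
  have hbc' : pderiv b (pderiv c (bhPoly a b c m s t)) = X a ^ m * C t := by
    rw [pderiv_c_bhPoly hac hbc, pderiv_mul, pderiv_pow, pderiv_X_of_ne hab, mul_zero, zero_mul, zero_add, map_add,
      pderiv_X_of_ne hab, zero_add, pderiv_C_mul, pderiv_X_self, mul_one]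
  rw [hbc', pderiv_b_bhPoly hab hbc, pderiv_c_bhPoly hac hbc, eval_bhPoly] at hle
  simp only [map_mul, map_pow, map_add, eval_X, eval_C, Pi.single_eq_same, Pi.single_eq_of_ne' hab,
    Pi.single_eq_of_ne' hac, one_pow, mul_zero, mul_one, add_zero, one_mul] at hle
  linarith

/-- **Brändén–Huh, Prop. 2.24 (second statement), every degree `d ≥ 2`**: on any variable set with at least three elements
and for any `c < 2(1 - 1/d)` there is `f ∈ L^d_n` that is not `c`-Rayleigh ("for any `n ≥ 3` and any
`c < 2(1 - 1/d)`, there is `f ∈ L^d_n` that is not `c`-Rayleigh"). [cite: BrandenHuh2019, §2.4 Prop. 2.24] -/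
theorem exists_mem_lorentzian_not_isCRayleigh (h3 : ∃ a b c : σ, a ≠ b ∧ a ≠ c ∧ b ≠ c) {d : ℕ} (hd : 2 ≤ d) {r : ℝ}
    (hr : r < 2 * (1 - 1 / (d : ℝ))) : ∃ f ∈ lorentzian σ d, ¬ IsCRayleigh r f := by
  obtain ⟨a, b, c, hab, hac, hbc⟩ := h3
  obtain ⟨m, rfl⟩ : ∃ m, d = m + 2 := ⟨d - 2, by omega⟩
  refine ⟨bhPoly a b c m (2 * (1 - 1 / ((m : ℝ) + 2))) 1, bhPoly_mem_lorentzian_bh hab hac hbc m,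
    not_isCRayleigh_bhPoly hab hac hbc m ?_⟩
  rw [mul_one]
  push_cast at hr
  exact hr

/-- The same in Brändén–Huh's phrasing "(all polynomials in `L^d_n` are `c`-Rayleigh) ⟹ `c ≥ 2(1 - 1/d)`" (`n ≥ 3`,
`d ≥ 2`). [cite: BrandenHuh2019, §2.4 Prop. 2.24] -/
theorem le_of_forall_lorentzian_isCRayleigh (h3 : ∃ a b c : σ, a ≠ b ∧ a ≠ c ∧ b ≠ c) {d : ℕ} (hd : 2 ≤ d) {r : ℝ}
    (h : ∀ f ∈ lorentzian σ d, IsCRayleigh r f) : 2 * (1 - 1 / (d : ℝ)) ≤ r := by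
  by_contra hr
  obtain ⟨f, hf, hnot⟩ := exists_mem_lorentzian_not_isCRayleigh h3 hd (lt_of_not_ge hr)
  exact hnot (h f hf)

/-- **The optimal Rayleigh constant in degree `d ≥ 2` is `2(1 - 1/d)`** (`n ≥ 3`): all polynomials of `L^d_n` are
`c`-Rayleigh iff `2(1 - 1/d) ≤ c` (Prop. 2.19, `isCRayleigh_of_mem_lorentzian`, for `⟸`; Prop. 2.24 for `⟹`).
[cite: BrandenHuh2019, §2.4 Prop. 2.19, Prop. 2.24 ("we show that the bound in Proposition 2.19 is optimal")] -/
theorem forall_lorentzian_isCRayleigh_iff (h3 : ∃ a b c : σ, a ≠ b ∧ a ≠ c ∧ b ≠ c) {d : ℕ} (hd : 2 ≤ d) (r : ℝ) :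
    (∀ f ∈ lorentzian σ d, IsCRayleigh r f) ↔ 2 * (1 - 1 / (d : ℝ)) ≤ r :=
  ⟨le_of_forall_lorentzian_isCRayleigh h3 hd, fun hr _ hf ↦ (isCRayleigh_of_mem_lorentzian hf).mono hr⟩

end Optimal

end Literature.Combinatorics.LorentzianPolynomials

end
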